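import Literature.RepresentationTheory.FiniteGroups.SymmetricGroupCharacterDegreeCoeff
import Literature.NumberTheory.DiophantineGeometry.GLHighestWeightFacts
import Literature.NumberTheory.DiophantineGeometry.SymmetricGroupRepsKroneckerCharacterProofs
import Mathlib.GroupTheory.Perm.Centralizer
import HarnessLib

/-!
# Evaluation of the characters and Kronecker coefficients of the symmetric groups

Topic `Literature/RepresentationTheory/FiniteGroups`. COMPUTABLE evaluators, PROVED correct
against the tree's definitions: `MNEval.charValue` for the irreducible characters `χ^λ(σ)` of
`𝔖_n` (Murnaghan–Nakayama on exponent vectors; `spechtCharacter_eq_charValue`) and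
`MNEval.kronSum` for the Kronecker coefficients `g(λ, μ, ν) = kroneckerCoeff ℂ λ μ ν`
(`factorial_mul_kroneckerCoeff_eq_kronSum`, `kroneckerCoeff_pos_iff_kronSum_pos`):

  `χ^λ(σ) = MNEval.charValue λ.sortedParts n (cycleType σ, sorted)`,
  `n! · g(λ, μ, ν) = MNEval.kronSum n λ.sortedParts μ.sortedParts ν.sortedParts`.

## Characters

By Frobenius's formula (`spechtCharacter_eq_frobeniusChar`) and the factorization
`F_σ = ∏_{m ∈ cycleType σ} p_m · p_1^f` (`fixedWordPoly_eq_prod_cycleType`),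
`χ^λ(σ) = [x^{λ+ρ}] (p_{m_1} ⋯ p_{m_k} · a_ρ · p_1^f)` with `f` the number of fixed points. The
evaluator computes this coefficient by the exponent-vector form of the Murnaghan–Nakayama rule
(Macdonald I §7 Ex. 5, James–Kerber 2.4.7, Fulton–Harris Ex. 4.45):

* peel the power sums one at a time, `[x^α](p_m G) = ∑_{i : α_i ≥ m} [x^{α - m e_i}] G`
  (`coeff_psum_mul`), keeping the exponent vector as a list of `N = ℓ(λ)` naturals
  (`MNEval.mnCoeff`, `MNEval.stepList`); a branch whose new exponent collides with another
  entry is dropped, since `G` is antisymmetric (`coeff_eq_zero_of_antisymm_of_apply_eq`), and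
  the new list is re-sorted (a sign) and passed on in canonical form (`MNEval.callCanon`), so
  that the kernel's reduction cache turns the recursion into a dynamic programme over shapes;
* at the end, `[x^α](a_ρ · p_1^f)` is evaluated in CLOSED FORM (`MNEval.tailCoeff`): sort `α`
  by insertions counting the transpositions (`MNEval.sortDescF`, `MNEval.invCount`; each costs
  a sign, `coeff_fsupp_eq_sortDesc`, `sortCount_eq_invCount`), then for strictly decreasing `l`,
  `[x^l](a_ρ p_1^f) = f! ∏_{i<s}(l_i - l_s) / ∏ l_i!` (the degree formula
  `coeff_alternant_mul_psum_one_pow_mul_prod_factorial`), and `0` if two entries coincide.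

Everything is by structural recursion on lists (with accumulators, so that intermediate lists are
materialised by one weak-head normalisation) and `Finset.range` sums, so closed instances reduce
quickly in the kernel (`decide`). No new mathematics is claimed; the content is the proof that
the program computes Frobenius's coefficient.

## Kronecker coefficients

`MNEval.kronSum` is the class equation form of the character formula
`n! g(λ, μ, ν) = ∑_{σ ∈ 𝔖_n} χ^λ(σ) χ^μ(σ) χ^ν(σ)` (`kroneckerCoeff_eq_sum_spechtCharacter_holds`;
Fulton–Harris Ex. 4.51, James–Kerber 2.9):

  `n! g(λ, μ, ν) = ∑_{ρ} #{σ : cycleType σ = ρ} · χ^λ(ρ) χ^μ(ρ) χ^ν(ρ)`,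

summed over the cycle types `ρ` (multisets of parts `≥ 2` with sum `≤ n`), enumerated by the
program `MNEval.cycleTypes` (decreasing lists; sound, complete and without repetition:
`mem_cycleTypes_iff`, `nodup_cycleTypes`), the class sizes being Mathlib's
`Equiv.Perm.card_of_cycleType` (`MNEval.classSize`) and the character values the verified
Murnaghan–Nakayama evaluator `MNEval.charValue` (`spechtCharacter_eq_charValue`).

Closed instances reduce in the kernel (`decide`; seconds for `n ≤ 20`, about a minute for
`n = 24`): e.g. `g((2,2), (2,2), (2,2)) = 1`, or the positivity of the small Kronecker
coefficients entering Ikenmeyer–Panova's Thm. 4.6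
(`Literature/Computability/Complexity/OccurrenceObstructionsIP*.lean`).

## References

* I. G. Macdonald, *Symmetric Functions and Hall Polynomials*, 2nd ed. (1995), Ch. I §7, Ex. 5
  (Murnaghan–Nakayama from `p_m a_α = ∑ a_{α + m e_i}`). [Macdonald1995]
* G. James, A. Kerber, *The Representation Theory of the Symmetric Group* (1981), 2.3.15, 2.4.7.
  [JamesKerber1981]
* W. Fulton, J. Harris, *Representation Theory*, GTM 129, Thm. 4.10, (4.11), Ex. 4.45, and
  Ex. 4.51 with Cor. 2.16 (the character formula for `g(λ, μ, ν)`), §4.1 (class sizes `n!/z_ρ`).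
  [FultonHarrisGTM129]

## Mathlib and tree

Mathlib: `Finsupp.equivFunOnFinite`, `Finsupp.mapDomain_equiv_apply`, `Equiv.swap`,
`Fin.sum_univ_eq_sum_range`, `List.getElem?_set`, `Nat.Partition.ofSums`, `Multiset.sort`,
`Equiv.Perm.card_of_cycleType`, `Equiv.Perm.two_le_of_mem_cycleType`, `Finset.sum_comp`,
`Finset.sum_subset`, `Finset.sum_image`, `List.sum_toFinset`, `List.nodup_flatMap`.
Tree: `coeff_psum_mul`, `coeff_mapDomain_of_rename_eq`, `spechtCharacter_eq_frobeniusChar`,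
`frobeniusChar_eq_coeff_prod_cycleType`, `rename_prod_psum_mul_alternant_mul_pow`,
`coeff_eq_zero_of_antisymm_of_apply_eq`, `coeff_alternant_mul_psum_one_pow(_mul_prod_factorial)`,
`Weight.getD_filter_pos_of_pairwise`, `kroneckerCoeff_eq_sum_spechtCharacter_holds`.
-/

open scoped BigOperators
open MvPolynomial Finset
open Literature.RingTheory.SymmetricFunctions.SymmPoly (alternant rho rho_apply)
open Literature.NumberTheory.DiophantineGeometry (spechtCharacter numStandardTableaux kroneckerCoeff
  kroneckerCoeff_eq_sum_spechtCharacter_holds)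

namespace Literature.RepresentationTheory.FiniteGroups

namespace MNEval

/-! ### The program -/

section Program

/-! Data produced during the computation is built with accumulators and `List.reverseAux`, so that
one weak-head normalisation materialises a whole list: lazily built lists (`a :: f t`,
`List.set`, `List.map`) are re-traversed at every access by the kernel and make the evaluation
slower by orders of magnitude. The simple ("specification") versions of the same functions follow
in the next section and are what the proofs are about. -/

/-- **One branch of the Murnaghan–Nakayama step**: subtract `m` from the `i`-th entry of the
exponent list `α` (the prefix already passed is `pre`, reversed); `none` if `α_i < m` or if the
new entry equals another entry (the branch then vanishes by antisymmetry), otherwise the new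
list, materialised. [folklore] -/
def stepList : List ℕ → ℕ → ℕ → List ℕ → Option (List ℕ)
  | [], _, _, _ => none
  | a :: l, 0, m, pre =>
      if m ≤ a then
        (if pre.elem (a - m) || l.elem (a - m) then none else some (pre.reverseAux ((a - m) :: l)))
      else none
  | a :: l, i + 1, m, pre => stepList l i m (a :: pre)

/-- Insertion of `a` into a weakly decreasing list after the entries `≥ a` (passed entries in the
accumulator), materialised. [folklore] -/
def insAcc (a : ℕ) : List ℕ → List ℕ → List ℕ
  | [], acc => acc.reverseAux [a]
  | b :: l, acc => if b < a then acc.reverseAux (a :: b :: l) else insAcc a l (b :: acc)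

/-- Insertion sort into weakly decreasing order, materialised. [folklore] -/
def sortDescF : List ℕ → List ℕ
  | [] => []
  | a :: l => insAcc a (sortDescF l)  []

/-- The number of pairs of positions `p < q` with `α_p ≤ α_q` (the number of adjacent
transpositions used by the insertion sort, `sortCount_eq_invCount`). [folklore] -/
def invCount : List ℕ → ℕ
  | [] => 0
  | a :: l => l.countP (fun b => a ≤ b) + invCount l

/-- Call `rec` on a canonical copy of the list: every entry is first forced to a numeral (by the
`match`), so that equal exponent lists reached along different branches give SYNTACTICALLY equal
calls, which the kernel's reduction cache identifies — the recursion below thereby runs as a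
dynamic programme over (skew) shapes rather than over removal sequences. Semantically
`callCanon rec l acc = rec (reverse acc ++ l)` (`callCanon_eq`). [folklore] -/
def callCanon (rec : List ℕ → ℤ) : List ℕ → List ℕ → ℤ
  | [], acc => rec (acc.reverseAux [])
  | a :: t, acc =>
      match a with
      | 0 => callCanon rec t (0 :: acc)
      | k + 1 => callCanon rec t ((k + 1) :: acc)

/-- The signed sum of `rec` over the surviving branches at positions `< k` (accumulator `acc`):
each new exponent list is re-sorted (sign `(-1)^{#inversions}`, `coeff_fsupp_eq_sortDesc`) and
passed on canonically. [folklore] -/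
def mnSum (rec : List ℕ → ℤ) (α : List ℕ) (m : ℕ) : ℕ → ℤ → ℤ
  | 0, acc => acc
  | i + 1, acc =>
      match stepList α i m [] with
      | none => mnSum rec α m i acc
      | some α' => mnSum rec α m i (acc + (-1) ^ invCount α' * callCanon rec (sortDescF α') [])

/-- Is the list strictly decreasing? [folklore] -/
def strictDesc : List ℕ → Bool
  | [] => true
  | [_] => true
  | a :: b :: l => decide (b < a) && strictDesc (b :: l)

/-- `∏_{i < s < N} (l_i - l_s)` (natural subtraction; the genuine differences on a decreasing
list). [folklore] -/
def vandProd (N : ℕ) (l : List ℕ) : ℕ :=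
  ∏ i ∈ range N, ∏ s ∈ range N, if i < s then l.getD i 0 - l.getD s 0 else 1

/-- `∏_{i < N} l_i!`. [folklore] -/
def factProd (N : ℕ) (l : List ℕ) : ℕ := ∏ i ∈ range N, (l.getD i 0).factorial

/-- **The closed form of the tail** `[x^α] (a_ρ · p_1^f)` for an exponent list `α` of length `N`
and total degree `f + N(N-1)/2`: sort `α` (sign `(-1)^{#inversions}`); if the sorted list `l`
is strictly decreasing the value is `± f! ∏_{i<s}(l_i - l_s) / ∏ l_i!` (the degree `f^κ` of the
shape `κ = l - ρ`, Fulton–Harris (4.11)), otherwise `0`. [cite: FultonHarrisGTM129, (4.11)] -/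
def tailCoeff (N f : ℕ) (α : List ℕ) : ℤ :=
  if strictDesc (sortDescF α) then
    (-1) ^ invCount α *
      ((f.factorial * vandProd N (sortDescF α) / factProd N (sortDescF α) : ℕ) : ℤ)
  else 0

/-- **Murnaghan–Nakayama on exponent lists**:
`mnCoeff N f ms α = [x^α] (∏_{m ∈ ms} p_m · a_ρ · p_1^f)` for `α` of length `N` and the right total
degree (`mnCoeff_eq_coeff`): peel `p_m` by `[x^α](p_m G) = ∑_{i : α_i ≥ m} [x^{α - m e_i}] G`,
dropping the branches in which the new entry collides with another one (they vanish by
antisymmetry) and re-sorting the others (`mnSum`). [cite: Macdonald1995, Ch. I §7 Example 5] -/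
def mnCoeff (N f : ℕ) : List ℕ → List ℕ → ℤ
  | [], α => tailCoeff N f α
  | m :: ms, α => mnSum (mnCoeff N f ms) α m N 0

/-- The `β`-numbers with an accumulator: `betaAux t k acc = reverse acc ++ [t_0 + k, t_1 + (k-1), …]`.
[folklore] -/
def betaAux : List ℕ → ℕ → List ℕ → List ℕ
  | [], _, acc => acc.reverseAux []
  | a :: t, k, acc => betaAux t (k - 1) ((a + k) :: acc)

/-- The `β`-numbers `λ_i + (N - 1 - i)`, `i < N = ℓ`, of a list of parts, materialised.
[folklore] -/
def betaList (L : List ℕ) : List ℕ := betaAux L (L.length - 1) []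

/-- **The character value** `χ^λ(σ)` from the parts `L` of `λ ⊢ n` (decreasing, positive) and the
list `ms` of lengths of the non-trivial cycles of `σ` (`spechtCharacter_eq_charValue`).
[cite: JamesKerber1981, 2.4.7 with 2.3.15] -/
def charValue (L : List ℕ) (n : ℕ) (ms : List ℕ) : ℤ :=
  mnCoeff L.length (n - ms.sum) ms (betaList L)

end Program

/-! ### Specification versions of the program -/

section Spec

/-- Subtract `m` from the `i`-th entry of an exponent list. [folklore] -/
def subAt (α : List ℕ) (i m : ℕ) : List ℕ := α.set i (α.getD i 0 - m)

/-- Insert into a weakly decreasing list, after the entries `≥ a`. [folklore] -/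
def insertDesc (a : ℕ) : List ℕ → List ℕ
  | [] => [a]
  | b :: l => if b < a then a :: b :: l else b :: insertDesc a l

/-- The number of entries passed by `insertDesc a` (adjacent transpositions used). [folklore] -/
def insCount (a : ℕ) : List ℕ → ℕ
  | [] => 0
  | b :: l => if b < a then 0 else insCount a l + 1

/-- Insertion sort into weakly decreasing order. [folklore] -/
def sortDesc : List ℕ → List ℕ
  | [] => []
  | a :: l => insertDesc a (sortDesc l)

/-- The number of adjacent transpositions used by `sortDesc`. [folklore] -/
def sortCount : List ℕ → ℕ
  | [] => 0
  | a :: l => sortCount l + insCount a (sortDesc l)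

end Spec

/-! ### Elementary properties of the program -/

section Lemmas

/-- `insertDesc` adds one entry. [folklore] -/
theorem length_insertDesc (a : ℕ) (l : List ℕ) : (insertDesc a l).length = l.length + 1 := by
  induction l with
  | nil => rfl
  | cons b l ih =>
    simp only [insertDesc]
    split_ifs
    · rfl
    · simp [ih]

/-- `sortDesc` preserves the length. [folklore] -/
theorem length_sortDesc (l : List ℕ) : (sortDesc l).length = l.length := by
  induction l with
  | nil => rfl
  | cons a l ih => rw [sortDesc, length_insertDesc, ih, List.length_cons]

/-- `insertDesc a l` is a permutation of `a :: l`. [folklore] -/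
theorem perm_insertDesc (a : ℕ) (l : List ℕ) : (insertDesc a l).Perm (a :: l) := by
  induction l with
  | nil => exact List.Perm.refl _
  | cons b l ih =>
    simp only [insertDesc]
    split_ifs
    · exact List.Perm.refl _
    · exact ((ih.cons b).trans (List.Perm.swap a b l))

/-- `sortDesc l` is a permutation of `l`. [folklore] -/
theorem perm_sortDesc (l : List ℕ) : (sortDesc l).Perm l := by
  induction l with
  | nil => exact List.Perm.refl _
  | cons a l ih => exact (perm_insertDesc a _).trans (ih.cons a)

/-- Sorting preserves the sum. [folklore] -/
theorem sum_sortDesc (l : List ℕ) : (sortDesc l).sum = l.sum := (perm_sortDesc l).sum_eq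

/-- `insertDesc` preserves weakly decreasing order. [folklore] -/
theorem sorted_insertDesc (a : ℕ) {l : List ℕ} (hl : l.Pairwise (· ≥ ·)) :
    (insertDesc a l).Pairwise (· ≥ ·) := by
  induction l with
  | nil => simp [insertDesc]
  | cons b l ih =>
    rw [List.pairwise_cons] at hl
    simp only [insertDesc]
    split_ifs with hba
    · refine List.pairwise_cons.2 ⟨fun x hx => ?_, List.pairwise_cons.2 hl⟩
      rcases List.mem_cons.1 hx with rfl | hx
      · exact hba.le
      · exact (hl.1 x hx).trans hba.le
    · refine List.pairwise_cons.2 ⟨fun x hx => ?_, ih hl.2⟩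
      rcases (perm_insertDesc a l).mem_iff.1 hx |> List.mem_cons.1 with rfl | hx
      · exact not_lt.1 hba
      · exact hl.1 x hx

/-- `sortDesc` sorts. [folklore] -/
theorem sorted_sortDesc (l : List ℕ) : (sortDesc l).Pairwise (· ≥ ·) := by
  induction l with
  | nil => exact List.Pairwise.nil
  | cons a l ih => exact sorted_insertDesc a ih

/-- `strictDesc` detects strictly decreasing lists. [folklore] -/
theorem strictDesc_eq_true_iff : ∀ l : List ℕ, strictDesc l = true ↔ l.Pairwise (· > ·)
  | [] => by simp [strictDesc]
  | [a] => by simp [strictDesc]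
  | a :: b :: l => by
    rw [strictDesc, Bool.and_eq_true, decide_eq_true_iff, strictDesc_eq_true_iff (b :: l)]
    constructor
    · rintro ⟨hba, h⟩
      refine List.pairwise_cons.2 ⟨fun x hx => ?_, h⟩
      rcases List.mem_cons.1 hx with rfl | hx
      · exact hba
      · exact lt_trans ((List.pairwise_cons.1 h).1 x hx) hba
    · intro h
      rw [List.pairwise_cons] at h
      exact ⟨h.1 b (by simp), h.2⟩

/-- A weakly decreasing list which is not strictly decreasing has two equal adjacent entries.
[folklore] -/
theorem exists_adjacent_eq_of_strictDesc_eq_false :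
    ∀ {l : List ℕ}, l.Pairwise (· ≥ ·) → strictDesc l = false →
      ∃ (pre : List ℕ) (a : ℕ) (s : List ℕ), l = pre ++ a :: a :: s
  | [], _, h => by simp [strictDesc] at h
  | [a], _, h => by simp [strictDesc] at h
  | a :: b :: l, hs, h => by
    rw [List.pairwise_cons] at hs
    rw [strictDesc, Bool.and_eq_false_iff, decide_eq_false_iff_not] at h
    rcases h with hba | h
    · have hab : a = b := le_antisymm (not_lt.1 hba) (hs.1 b (by simp))
      exact ⟨[], a, l, by rw [hab]; rfl⟩
    · obtain ⟨pre, c, s, hcs⟩ := exists_adjacent_eq_of_strictDesc_eq_false hs.2 h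
      exact ⟨a :: pre, c, s, by rw [hcs]; rfl⟩

/-- Entries of a strictly decreasing list of naturals dominate the staircase:
`l_i ≥ |l| - 1 - i`. [folklore] -/
theorem length_sub_le_getD_of_pairwise_gt :
    ∀ {l : List ℕ}, l.Pairwise (· > ·) → ∀ i, i < l.length → l.length - 1 - i ≤ l.getD i 0
  | [], _, i, hi => by simp at hi
  | a :: t, h, 0, _ => by
    rw [List.pairwise_cons] at h
    rw [List.getD_cons_zero, List.length_cons]
    cases t with
    | nil => simp
    | cons b t' =>
      have hb := length_sub_le_getD_of_pairwise_gt h.2 0 (by simp)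
      rw [List.getD_cons_zero] at hb
      have hab : b < a := h.1 b (by simp)
      simp only [List.length_cons] at hb ⊢
      omega
  | a :: t, h, i + 1, hi => by
    rw [List.pairwise_cons] at h
    rw [List.getD_cons_succ, List.length_cons]
    have := length_sub_le_getD_of_pairwise_gt h.2 i (by simpa using hi)
    omega

/-- `subAt` preserves the length. [folklore] -/
theorem length_subAt (α : List ℕ) (i m : ℕ) : (subAt α i m).length = α.length := by
  rw [subAt, List.length_set]

/-- `subAt` does not change the other entries. [folklore] -/
theorem getD_subAt_of_ne (α : List ℕ) {i j : ℕ} (m : ℕ) (h : j ≠ i) :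
    (subAt α i m).getD j 0 = α.getD j 0 := by
  rw [subAt, List.getD_eq_getElem?_getD, List.getElem?_set, if_neg (Ne.symm h).symm.symm,
    ← List.getD_eq_getElem?_getD]

/-- `subAt` lowers the `i`-th entry by `m`. [folklore] -/
theorem getD_subAt_self (α : List ℕ) {i : ℕ} (m : ℕ) (hi : i < α.length) :
    (subAt α i m).getD i 0 = α.getD i 0 - m := by
  rw [subAt, List.getD_eq_getElem?_getD, List.getElem?_set, if_pos rfl, if_pos hi, Option.getD_some]

/-- Lowering an entry by `m ≤ α_i` lowers the sum by `m`. [folklore] -/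
theorem sum_subAt_add : ∀ (α : List ℕ) (i m : ℕ), i < α.length → m ≤ α.getD i 0 →
    (subAt α i m).sum + m = α.sum
  | [], i, m, hi, _ => by simp at hi
  | a :: t, 0, m, _, hm => by
    rw [List.getD_cons_zero] at hm
    simp only [subAt, List.getD_cons_zero, List.set_cons_zero, List.sum_cons]
    omega
  | a :: t, i + 1, m, hi, hm => by
    rw [List.getD_cons_succ] at hm
    have h := sum_subAt_add t i m (by simpa using hi) hm
    simp only [subAt, List.getD_cons_succ, List.set_cons_succ, List.sum_cons] at h ⊢
    omega

/-- The materialised insertion is the simple one. [folklore] -/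
theorem insAcc_eq (a : ℕ) : ∀ (l acc : List ℕ), insAcc a l acc = acc.reverseAux (insertDesc a l)
  | [], acc => rfl
  | b :: l, acc => by
    rw [insAcc, insertDesc]
    split_ifs with h
    · rfl
    · rw [insAcc_eq a l (b :: acc)]
      rfl

/-- The materialised sort is the simple one. [folklore] -/
theorem sortDescF_eq : ∀ l : List ℕ, sortDescF l = sortDesc l
  | [] => rfl
  | a :: l => by rw [sortDescF, sortDesc, sortDescF_eq l, insAcc_eq]; rfl

/-- `callCanon` is a call on the list itself. [folklore] -/
theorem callCanon_eq (rec : List ℕ → ℤ) : ∀ (l acc : List ℕ),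
    callCanon rec l acc = rec (acc.reverse ++ l)
  | [], acc => by simp [callCanon, List.reverseAux_eq]
  | a :: l, acc => by
    cases a with
    | zero => rw [callCanon, callCanon_eq rec l (0 :: acc)]; simp
    | succ k => rw [callCanon, callCanon_eq rec l ((k + 1) :: acc)]; simp

/-- On a weakly decreasing list, `insertDesc a` passes exactly the entries `≥ a`. [folklore] -/
theorem insCount_eq_countP (a : ℕ) : ∀ {s : List ℕ}, s.Pairwise (· ≥ ·) →
    insCount a s = s.countP (fun b => a ≤ b)
  | [], _ => rfl
  | b :: s, hs => by
    rw [List.pairwise_cons] at hs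
    rw [insCount, List.countP_cons]
    by_cases hba : b < a
    · rw [if_pos hba]
      have h0 : s.countP (fun c => a ≤ c) = 0 :=
        List.countP_eq_zero.2 fun c hc => by simpa using lt_of_le_of_lt (hs.1 c hc) hba
      rw [h0]
      simp [not_le.2 hba]
    · rw [if_neg hba, insCount_eq_countP a hs.2]
      simp [not_lt.1 hba]

/-- **The transposition count of the insertion sort is the inversion count.** [folklore] -/
theorem sortCount_eq_invCount : ∀ l : List ℕ, sortCount l = invCount l
  | [] => rfl
  | a :: l => by
    rw [sortCount, invCount, sortCount_eq_invCount l, insCount_eq_countP a (sorted_sortDesc l),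
      (perm_sortDesc l).countP_eq, add_comm]

/-- The materialised `β`-numbers. [folklore] -/
theorem betaAux_eq : ∀ (t : List ℕ) (k : ℕ) (acc : List ℕ),
    betaAux t k acc = acc.reverse ++ (List.range t.length).map fun j => t.getD j 0 + (k - j)
  | [], k, acc => by simp [betaAux, List.reverseAux_eq]
  | a :: t, k, acc => by
    rw [betaAux, betaAux_eq t (k - 1) ((a + k) :: acc), List.length_cons, List.range_succ_eq_map,
      List.map_cons, List.map_map, List.reverse_cons, List.append_assoc, List.singleton_append,
      List.getD_cons_zero, Nat.sub_zero]
    congr 2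
    refine List.map_congr_left fun j _ => ?_
    rw [Function.comp_apply, List.getD_cons_succ, Nat.sub_sub, Nat.add_comm 1 j]

/-- `betaList L = [L_0 + (N-1), L_1 + (N-2), …, L_{N-1}]`. [folklore] -/
theorem betaList_eq (L : List ℕ) :
    betaList L = (List.range L.length).map fun i => L.getD i 0 + (L.length - 1 - i) := by
  rw [betaList, betaAux_eq, List.reverse_nil, List.nil_append]

/-- There are `|L|` `β`-numbers. [folklore] -/
theorem length_betaList (L : List ℕ) : (betaList L).length = L.length := by
  rw [betaList_eq, List.length_map, List.length_range]

/-- The `i`-th `β`-number is `L_i + (|L| - 1 - i)`. [folklore] -/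
theorem getD_betaList (L : List ℕ) {i : ℕ} (hi : i < L.length) :
    (betaList L).getD i 0 = L.getD i 0 + (L.length - 1 - i) := by
  rw [betaList_eq, List.getD_eq_getElem?_getD, List.getElem?_map, List.getElem?_range hi, Option.map_some,
    Option.getD_some]

/-- The list of its first `|L|` default-extended entries is the list itself. [folklore] -/
theorem map_getD_range (L : List ℕ) : (List.range L.length).map (fun i => L.getD i 0) = L := by
  refine List.ext_getElem (by simp) fun i h1 h2 => ?_
  rw [List.getElem_map, List.getElem_range, List.getD_eq_getElem?_getD, List.getElem?_eq_getElem h2,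
    Option.getD_some]

/-- Sums over `List.range` are `Finset.range` sums. [folklore] -/
theorem sum_map_range {M : Type*} [AddCommMonoid M] (g : ℕ → M) (N : ℕ) :
    ((List.range N).map g).sum = ∑ i ∈ range N, g i := by
  rw [Finset.sum_eq_multiset_sum, Finset.range_val]
  rfl

/-- `∑ β_i = ∑ λ_i + N(N-1)/2`. [folklore] -/
theorem sum_betaList (L : List ℕ) :
    (betaList L).sum = L.sum + L.length * (L.length - 1) / 2 := by
  rw [betaList_eq, List.sum_map_add]
  conv_lhs => rw [map_getD_range L, sum_map_range, Finset.sum_range_reflect (fun i => i) L.length,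
    Finset.sum_range_id]

end Lemmas

/-! ### Exponent lists as exponent vectors, and the effect of an adjacent transposition -/

section Fsupp

variable {N : ℕ}

/-- The exponent vector `i ↦ l_i` (`i < N`) of an exponent list. [folklore] -/
noncomputable def fsupp (N : ℕ) (l : List ℕ) : Fin N →₀ ℕ :=
  Finsupp.equivFunOnFinite.symm fun i => l.getD i 0

/-- The exponent vector of a list, entrywise. [folklore] -/
@[simp]
theorem fsupp_apply (l : List ℕ) (i : Fin N) : fsupp N l i = l.getD i 0 := by
  rw [fsupp, Finsupp.coe_equivFunOnFinite_symm]

/-- Subtracting `m e_i` from the vector is `subAt` on the list. [folklore] -/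
theorem fsupp_sub_single (l : List ℕ) (hl : l.length = N) (i : Fin N) (m : ℕ) :
    fsupp N l - Finsupp.single i m = fsupp N (subAt l i m) := by
  ext x
  rw [Finsupp.coe_tsub, Pi.sub_apply, fsupp_apply, fsupp_apply, Finsupp.single_apply]
  by_cases h : i = x
  · subst h
    rw [if_pos rfl, getD_subAt_self l m (by rw [hl]; exact i.2)]
  · rw [if_neg h, Nat.sub_zero, getD_subAt_of_ne l m (fun h' => h (Fin.ext h'.symm))]

/-- `getD` through a prefix. [folklore] -/
theorem getD_append_add (pre t : List ℕ) (k : ℕ) :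
    (pre ++ t).getD (pre.length + k) 0 = t.getD k 0 := by
  rw [List.getD_eq_getElem?_getD, List.getElem?_append_right (by omega), Nat.add_sub_cancel_left,
    ← List.getD_eq_getElem?_getD]

/-- `getD` inside a prefix. [folklore] -/
theorem getD_append_of_lt (pre t : List ℕ) {x : ℕ} (hx : x < pre.length) :
    (pre ++ t).getD x 0 = pre.getD x 0 := by
  rw [List.getD_eq_getElem?_getD, List.getElem?_append_left hx, ← List.getD_eq_getElem?_getD]

/-- **An adjacent transposition of the list is a transposition of the exponent vector.**
[folklore] -/
theorem fsupp_swap_adjacent (pre s : List ℕ) (a b : ℕ) (hk : pre.length + 1 < N) :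
    fsupp N (pre ++ a :: b :: s) =
      Finsupp.mapDomain (Equiv.swap (⟨pre.length, by omega⟩ : Fin N) ⟨pre.length + 1, hk⟩)
        (fsupp N (pre ++ b :: a :: s)) := by
  ext x
  rw [Finsupp.mapDomain_equiv_apply, Equiv.symm_swap, fsupp_apply, fsupp_apply]
  by_cases h0 : x = ⟨pre.length, by omega⟩
  · rw [h0, Equiv.swap_apply_left]
    change (pre ++ a :: b :: s).getD (pre.length + 0) 0 = (pre ++ b :: a :: s).getD (pre.length + 1) 0
    rw [getD_append_add, getD_append_add]
    rfl
  · by_cases h1 : x = ⟨pre.length + 1, hk⟩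
    · rw [h1, Equiv.swap_apply_right]
      change (pre ++ a :: b :: s).getD (pre.length + 1) 0 = (pre ++ b :: a :: s).getD (pre.length + 0) 0
      rw [getD_append_add, getD_append_add]
      rfl
    · rw [Equiv.swap_apply_of_ne_of_ne h0 h1]
      have hx0 : (x : ℕ) ≠ pre.length := fun h => h0 (Fin.ext h)
      have hx1 : (x : ℕ) ≠ pre.length + 1 := fun h => h1 (Fin.ext h)
      rcases lt_or_gt_of_ne hx0 with hlt | hgt
      · rw [getD_append_of_lt _ _ hlt, getD_append_of_lt _ _ hlt]
      · obtain ⟨k, hk'⟩ : ∃ k, (x : ℕ) = pre.length + (k + 2) := ⟨x - pre.length - 2, by omega⟩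
        rw [hk', getD_append_add, getD_append_add]
        rfl

variable {H : MvPolynomial (Fin N) ℤ}

/-- **Swapping two adjacent exponents changes the sign of the coefficient** of an antisymmetric
polynomial. [folklore] -/
theorem coeff_fsupp_swap_adjacent
    (hH : ∀ g : Equiv.Perm (Fin N), rename g H = ((Equiv.Perm.sign g : ℤ) : MvPolynomial (Fin N) ℤ) * H)
    (pre s : List ℕ) (a b : ℕ) (hk : pre.length + 1 < N) :
    coeff (fsupp N (pre ++ a :: b :: s)) H = - coeff (fsupp N (pre ++ b :: a :: s)) H := by
  rw [fsupp_swap_adjacent pre s a b hk, coeff_mapDomain_of_rename_eq (hH _), Equiv.Perm.sign_swap]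
  · simp
  · intro h
    rw [Fin.ext_iff] at h
    simp at h

/-- Two equal adjacent exponents kill the coefficient of an antisymmetric polynomial. [folklore] -/
theorem coeff_fsupp_adjacent_eq
    (hH : ∀ g : Equiv.Perm (Fin N), rename g H = ((Equiv.Perm.sign g : ℤ) : MvPolynomial (Fin N) ℤ) * H)
    (pre s : List ℕ) (a : ℕ) (hk : pre.length + 1 < N) :
    coeff (fsupp N (pre ++ a :: a :: s)) H = 0 := by
  have h := coeff_fsupp_swap_adjacent hH pre s a a hk
  omega

/-- **Inserting an entry into the sorted tail costs one sign per entry passed.** [folklore] -/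
theorem coeff_fsupp_insertDesc
    (hH : ∀ g : Equiv.Perm (Fin N), rename g H = ((Equiv.Perm.sign g : ℤ) : MvPolynomial (Fin N) ℤ) * H)
    (a : ℕ) : ∀ (s pre : List ℕ), pre.length + 1 + s.length ≤ N →
      coeff (fsupp N (pre ++ a :: s)) H =
        (-1) ^ insCount a s * coeff (fsupp N (pre ++ insertDesc a s)) H
  | [], pre, _ => by simp [insertDesc, insCount]
  | b :: s, pre, hlen => by
    simp only [insertDesc, insCount]
    split_ifs with hba
    · simp
    · rw [coeff_fsupp_swap_adjacent hH pre s a b (by simp at hlen; omega),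
        show pre ++ b :: a :: s = (pre ++ [b]) ++ a :: s by simp,
        coeff_fsupp_insertDesc hH a s (pre ++ [b]) (by simp at hlen ⊢; omega),
        show (pre ++ [b]) ++ insertDesc a s = pre ++ b :: insertDesc a s by simp, pow_succ]
      ring

/-- **Sorting the exponent list costs the sign `(-1)^{sortCount}`.** [folklore] -/
theorem coeff_fsupp_sortDesc_aux
    (hH : ∀ g : Equiv.Perm (Fin N), rename g H = ((Equiv.Perm.sign g : ℤ) : MvPolynomial (Fin N) ℤ) * H) :
    ∀ (t pre : List ℕ), pre.length + t.length ≤ N →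
      coeff (fsupp N (pre ++ t)) H = (-1) ^ sortCount t * coeff (fsupp N (pre ++ sortDesc t)) H
  | [], pre, _ => by simp [sortDesc, sortCount]
  | a :: t, pre, hlen => by
    rw [show pre ++ a :: t = (pre ++ [a]) ++ t by simp,
      coeff_fsupp_sortDesc_aux hH t (pre ++ [a]) (by simp at hlen ⊢; omega),
      show (pre ++ [a]) ++ sortDesc t = pre ++ a :: sortDesc t by simp,
      coeff_fsupp_insertDesc hH a (sortDesc t) pre (by rw [length_sortDesc]; simp at hlen; omega),
      sortDesc, sortCount, pow_add]
    ring

/-- **Sorting the exponent list costs the sign `(-1)^{sortCount}`** (antisymmetric `H`, list of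
length `≤ N`). [folklore] -/
theorem coeff_fsupp_eq_sortDesc
    (hH : ∀ g : Equiv.Perm (Fin N), rename g H = ((Equiv.Perm.sign g : ℤ) : MvPolynomial (Fin N) ℤ) * H)
    (α : List ℕ) (hα : α.length ≤ N) :
    coeff (fsupp N α) H = (-1) ^ sortCount α * coeff (fsupp N (sortDesc α)) H := by
  simpa using coeff_fsupp_sortDesc_aux hH α [] (by simpa using hα)

end Fsupp

/-! ### The tail: `[x^α] (a_ρ · p_1^f)` in closed form -/

section Tail

variable {N f : ℕ}

/-- The polynomial `a_ρ · p_1^f` is antisymmetric. [folklore] -/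
private theorem rename_alternant_mul_pow (g : Equiv.Perm (Fin N)) :
    rename g (alternant (fun i => (X i : MvPolynomial (Fin N) ℤ)) (rho N) * psum (Fin N) ℤ 1 ^ f) =
      ((Equiv.Perm.sign g : ℤ) : MvPolynomial (Fin N) ℤ) *
        (alternant (fun i => (X i : MvPolynomial (Fin N) ℤ)) (rho N) * psum (Fin N) ℤ 1 ^ f) := by
  simpa using rename_prod_psum_mul_alternant_mul_pow [] f g

/-- The rows `κ_i = l_i - (N - 1 - i)` (`i < N`) of a strictly decreasing exponent list `l`.
[folklore] -/
def rowsOfBeta (N : ℕ) (l : List ℕ) (i : ℕ) : ℕ := if i < N then l.getD i 0 - (N - 1 - i) else 0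

/-- The row list of `rowsOfBeta`. [folklore] -/
def rowListOfBeta (N : ℕ) (l : List ℕ) : List ℕ := (List.range N).map (rowsOfBeta N l)

/-- `κ_i + (N - 1 - i) = l_i` for a strictly decreasing exponent list. [folklore] -/
theorem getD_add_eq_of_pairwise_gt {l : List ℕ} (hl : l.Pairwise (· > ·)) (hN : l.length = N) {i : ℕ}
    (hi : i < N) : rowsOfBeta N l i + (N - 1 - i) = l.getD i 0 := by
  rw [rowsOfBeta, if_pos hi]
  have := length_sub_le_getD_of_pairwise_gt hl i (by omega)
  rw [hN] at this
  omega

/-- The rows of a strictly decreasing exponent list decrease weakly. [folklore] -/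
theorem rowsOfBeta_antitone_step {l : List ℕ} (hl : l.Pairwise (· > ·)) (hN : l.length = N) (i : ℕ) :
    rowsOfBeta N l (i + 1) ≤ rowsOfBeta N l i := by
  by_cases hi1 : i + 1 < N
  · have h0 := getD_add_eq_of_pairwise_gt hl hN (show i < N by omega)
    have h1 := getD_add_eq_of_pairwise_gt hl hN hi1
    have hlt : l.getD (i + 1) 0 < l.getD i 0 := by
      have hp := List.pairwise_iff_getElem.1 hl i (i + 1) (by omega) (by omega) (by omega)
      rw [List.getD_eq_getElem?_getD, List.getD_eq_getElem?_getD,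
        List.getElem?_eq_getElem (show i + 1 < l.length by omega),
        List.getElem?_eq_getElem (show i < l.length by omega), Option.getD_some, Option.getD_some]
      exact hp
    omega
  · rw [rowsOfBeta, if_neg hi1]
    exact Nat.zero_le _

/-- The row list of a strictly decreasing exponent list decreases weakly. [folklore] -/
theorem pairwise_rowListOfBeta {l : List ℕ} (hl : l.Pairwise (· > ·)) (hN : l.length = N) :
    (rowListOfBeta N l).Pairwise (· ≥ ·) := by
  rw [rowListOfBeta, List.pairwise_map]
  refine List.pairwise_lt_range.imp fun {a b} hab => ?_
  -- antitone along the chain a < b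
  obtain ⟨k, rfl⟩ : ∃ k, b = a + k + 1 := ⟨b - a - 1, by omega⟩
  induction k with
  | zero => simpa using rowsOfBeta_antitone_step hl hN a
  | succ k ih =>
    have := rowsOfBeta_antitone_step hl hN (a + k + 1)
    have ih' := ih (by omega)
    rw [show a + (k + 1) + 1 = a + k + 1 + 1 by ring]
    exact le_trans this ih'

/-- `∑_{i<N} κ_i = f` when `∑ l = f + N(N-1)/2`. [folklore] -/
theorem sum_rowListOfBeta {l : List ℕ} (hl : l.Pairwise (· > ·)) (hN : l.length = N)
    (hsum : l.sum = f + N * (N - 1) / 2) : (rowListOfBeta N l).sum = f := by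
  have h1 : ((List.range N).map fun i => rowsOfBeta N l i + (N - 1 - i)).sum = l.sum := by
    conv_rhs => rw [← map_getD_range l, hN]
    congr 1
    exact List.map_congr_left fun i hi => getD_add_eq_of_pairwise_gt hl hN (List.mem_range.1 hi)
  rw [List.sum_map_add, sum_map_range (fun i => N - 1 - i), Finset.sum_range_reflect (fun i => i) N,
    Finset.sum_range_id, hsum] at h1
  rw [rowListOfBeta]
  omega

/-- **The shape `κ = l - ρ` of a strictly decreasing exponent list** `l` of length `N` and degree
`f + N(N-1)/2`, as a partition of `f`. [folklore] -/
def shapeOfBeta (l : List ℕ) (hl : l.Pairwise (· > ·)) (hN : l.length = N)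
    (hsum : l.sum = f + N * (N - 1) / 2) : Nat.Partition f :=
  Nat.Partition.ofSums f (rowListOfBeta N l : Multiset ℕ)
    (by rw [Multiset.sum_coe, sum_rowListOfBeta hl hN hsum])

/-- The sorted parts of the shape `l - ρ` are the nonzero rows. [folklore] -/
theorem sortedParts_shapeOfBeta {l : List ℕ} (hl : l.Pairwise (· > ·)) (hN : l.length = N)
    (hsum : l.sum = f + N * (N - 1) / 2) :
    (shapeOfBeta l hl hN hsum).sortedParts = (rowListOfBeta N l).filter (0 < ·) := by
  have hparts : (shapeOfBeta l hl hN hsum).parts = ((rowListOfBeta N l).filter (0 < ·) : List ℕ) := by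
    rw [shapeOfBeta, Nat.Partition.ofSums_parts, Multiset.filter_coe]
    congr 1
    exact List.filter_congr fun x _ => by simp [Nat.pos_iff_ne_zero]
  change (shapeOfBeta l hl hN hsum).parts.sort (· ≥ ·) = _
  rw [hparts, Multiset.coe_sort]
  exact List.mergeSort_eq_self (r := (· ≥ ·)) ((pairwise_rowListOfBeta hl hN).filter _)

/-- The rows of the shape `l - ρ`, zero-padded. [folklore] -/
theorem getD_sortedParts_shapeOfBeta {l : List ℕ} (hl : l.Pairwise (· > ·)) (hN : l.length = N)
    (hsum : l.sum = f + N * (N - 1) / 2) (i : ℕ) :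
    (shapeOfBeta l hl hN hsum).sortedParts.getD i 0 = rowsOfBeta N l i := by
  rw [sortedParts_shapeOfBeta hl hN hsum,
    Literature.NumberTheory.DiophantineGeometry.Weight.getD_filter_pos_of_pairwise
      (pairwise_rowListOfBeta hl hN), rowListOfBeta, List.getD_eq_getElem?_getD, List.getElem?_map]
  by_cases hi : i < N
  · rw [List.getElem?_range hi, Option.map_some, Option.getD_some]
  · rw [List.getElem?_eq_none (by simpa using not_lt.1 hi), Option.map_none, Option.getD_none, rowsOfBeta,
      if_neg hi]

/-- The shape `l - ρ` has at most `N` parts. [folklore] -/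
theorem card_parts_shapeOfBeta_le {l : List ℕ} (hl : l.Pairwise (· > ·)) (hN : l.length = N)
    (hsum : l.sum = f + N * (N - 1) / 2) : (shapeOfBeta l hl hN hsum).parts.card ≤ N := by
  rw [← Nat.Partition.length_sortedParts, sortedParts_shapeOfBeta hl hN hsum]
  exact (List.length_filter_le _ _).trans (by simp [rowListOfBeta])

/-- The cast of `vandProd` on a decreasing list is the product of the rational differences.
[folklore] -/
theorem cast_vandProd {l : List ℕ} (hl : l.Pairwise (· ≥ ·)) (hN : l.length = N) :
    ((vandProd N l : ℕ) : ℚ) =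
      ∏ i ∈ range N, ∏ s ∈ Ioo i N, (((l.getD i 0 : ℕ) : ℚ) - ((l.getD s 0 : ℕ) : ℚ)) := by
  rw [vandProd, Nat.cast_prod]
  refine Finset.prod_congr rfl fun i hi => ?_
  rw [Nat.cast_prod]
  have hIoo : Ioo i N = (range N).filter (fun s => i < s) := by
    ext s; simp [Finset.mem_Ioo, and_comm]
  rw [hIoo, Finset.prod_filter]
  refine Finset.prod_congr rfl fun s hs => ?_
  split_ifs with his
  · have hle : l.getD s 0 ≤ l.getD i 0 := by
      rw [Finset.mem_range] at hi hs
      have hp := List.pairwise_iff_getElem.1 hl i s (by omega) (by omega) his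
      rw [List.getD_eq_getElem?_getD, List.getD_eq_getElem?_getD,
        List.getElem?_eq_getElem (show s < l.length by omega),
        List.getElem?_eq_getElem (show i < l.length by omega), Option.getD_some, Option.getD_some]
      exact hp
    rw [Nat.cast_sub hle]
  · simp

/-- `∏ l_i! > 0`. [folklore] -/
theorem factProd_pos (N : ℕ) (l : List ℕ) : 0 < factProd N l :=
  Finset.prod_pos fun _ _ => Nat.factorial_pos _

/-- **The tail for a strictly decreasing exponent list**: `[x^l] (a_ρ · p_1^f)` is the natural
number `f! ∏_{i<s}(l_i - l_s) / ∏ l_i!` (exact division), i.e. `f^κ` for `κ = l - ρ`.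
[cite: FultonHarrisGTM129, (4.11)] -/
theorem coeff_fsupp_tail_sorted {l : List ℕ} (hl : l.Pairwise (· > ·)) (hN : l.length = N)
    (hsum : l.sum = f + N * (N - 1) / 2) :
    coeff (fsupp N l) (alternant (fun i => (X i : MvPolynomial (Fin N) ℤ)) (rho N) * psum (Fin N) ℤ 1 ^ f) =
      ((f.factorial * vandProd N l / factProd N l : ℕ) : ℤ) := by
  set κ := shapeOfBeta l hl hN hsum with hκ
  have hNκ := card_parts_shapeOfBeta_le hl hN hsum
  -- the exponent vector of `l` is `κ + ρ`
  have hvec : Finsupp.equivFunOnFinite.symm ((fun i : Fin N => κ.sortedParts.getD i 0) + rho N) =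
      fsupp N l := by
    ext i
    rw [Finsupp.coe_equivFunOnFinite_symm, fsupp_apply, Pi.add_apply, getD_sortedParts_shapeOfBeta,
      rho_apply, ← getD_add_eq_of_pairwise_gt hl hN i.2]
    have := i.2
    congr 1
    omega
  have hc := coeff_alternant_mul_psum_one_pow κ hNκ
  have hq := coeff_alternant_mul_psum_one_pow_mul_prod_factorial κ hNκ
  rw [hvec] at hc hq
  rw [hc] at hq ⊢
  -- rewrite the β-numbers `κ_i + (N-1-i) = l_i`
  have hβ : ∀ i ∈ range N, κ.sortedParts.getD i 0 + (N - 1 - i) = l.getD i 0 := fun i hi => by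
    rw [getD_sortedParts_shapeOfBeta]; exact getD_add_eq_of_pairwise_gt hl hN (Finset.mem_range.1 hi)
  have hP : ∏ i ∈ range N, ((κ.sortedParts.getD i 0 + (N - 1 - i)).factorial : ℚ) = (factProd N l : ℚ) := by
    rw [factProd, Nat.cast_prod]
    exact Finset.prod_congr rfl fun i hi => by rw [hβ i hi]
  have hV : ∏ i ∈ range N, ∏ s ∈ Ioo i N,
      (((κ.sortedParts.getD i 0 + (N - 1 - i) : ℕ) : ℚ) - ((κ.sortedParts.getD s 0 + (N - 1 - s) : ℕ) : ℚ)) =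
        (vandProd N l : ℚ) := by
    rw [cast_vandProd (hl.imp fun h => h.le) hN]
    refine Finset.prod_congr rfl fun i hi => Finset.prod_congr rfl fun s hs => ?_
    rw [hβ i hi, hβ s (Finset.mem_range.2 (Finset.mem_Ioo.1 hs).2)]
  rw [hP, hV, Int.cast_natCast] at hq
  have hnat : numStandardTableaux κ * factProd N l = f.factorial * vandProd N l := by exact_mod_cast hq
  rw [← hnat, Nat.mul_div_cancel _ (factProd_pos N l)]

/-- **The tail in general**: for an exponent list `α` of length `N` and degree `f + N(N-1)/2`,
`[x^α] (a_ρ · p_1^f) = tailCoeff N f α`. [cite: FultonHarrisGTM129, (4.11)] -/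
theorem coeff_fsupp_tail {α : List ℕ} (hN : α.length = N) (hsum : α.sum = f + N * (N - 1) / 2) :
    coeff (fsupp N α) (alternant (fun i => (X i : MvPolynomial (Fin N) ℤ)) (rho N) * psum (Fin N) ℤ 1 ^ f) =
      tailCoeff N f α := by
  rw [coeff_fsupp_eq_sortDesc rename_alternant_mul_pow α hN.le, tailCoeff, sortDescF_eq,
    ← sortCount_eq_invCount]
  have hNl : (sortDesc α).length = N := by rw [length_sortDesc, hN]
  have hsuml : (sortDesc α).sum = f + N * (N - 1) / 2 := by rw [sum_sortDesc, hsum]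
  by_cases hs : strictDesc (sortDesc α) = true
  · rw [if_pos hs, coeff_fsupp_tail_sorted ((strictDesc_eq_true_iff _).1 hs) hNl hsuml]
  · rw [if_neg hs]
    obtain ⟨pre, a, s, h⟩ := exists_adjacent_eq_of_strictDesc_eq_false (sorted_sortDesc α)
      (Bool.eq_false_iff.2 hs)
    have hlen : pre.length + 1 < N := by
      have := congrArg List.length h
      simp only [List.length_append, List.length_cons] at this
      omega
    rw [h, coeff_fsupp_adjacent_eq rename_alternant_mul_pow pre s a hlen, mul_zero]

end Tail

/-! ### The recursion -/

section Recursion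

variable {N f : ℕ}

/-- **What `stepList` computes**: the branch at position `i` survives iff `i < |l|`, `m ≤ l_i`
and the new entry `l_i - m` occurs neither in the passed prefix nor elsewhere in `l`; the result
is then `reverse pre ++ l` with `l_i` lowered by `m`. [folklore] -/
theorem stepList_eq : ∀ (l : List ℕ) (i m : ℕ) (pre : List ℕ),
    stepList l i m pre =
      if i < l.length ∧ m ≤ l.getD i 0 ∧ (l.getD i 0 - m) ∉ pre ∧ (l.getD i 0 - m) ∉ l.eraseIdx i
      then some (pre.reverse ++ l.set i (l.getD i 0 - m)) else none
  | [], i, m, pre => by simp [stepList]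
  | a :: l, 0, m, pre => by
    simp only [stepList, List.length_cons, Nat.zero_lt_succ, true_and, List.getD_cons_zero,
      List.eraseIdx_cons_zero, List.set_cons_zero, List.reverseAux_eq]
    by_cases hm : m ≤ a
    · rw [if_pos hm]
      by_cases h : a - m ∈ pre ∨ a - m ∈ l
      · rw [if_pos, if_neg (by tauto)]
        simpa [Bool.or_eq_true, List.elem_iff] using h
      · rw [if_neg, if_pos ⟨hm, by tauto⟩]
        simpa [Bool.or_eq_true, List.elem_iff] using h
    · rw [if_neg hm, if_neg (by tauto)]
  | a :: l, i + 1, m, pre => by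
    rw [stepList, stepList_eq l i m (a :: pre)]
    have key : (i < l.length ∧ m ≤ l.getD i 0 ∧ (l.getD i 0 - m) ∉ a :: pre ∧
        (l.getD i 0 - m) ∉ l.eraseIdx i) ↔
        (i + 1 < (a :: l).length ∧ m ≤ (a :: l).getD (i + 1) 0 ∧
          ((a :: l).getD (i + 1) 0 - m) ∉ pre ∧
            ((a :: l).getD (i + 1) 0 - m) ∉ (a :: l).eraseIdx (i + 1)) := by
      simp only [List.length_cons, Nat.succ_lt_succ_iff, List.getD_cons_succ, List.mem_cons,
        List.eraseIdx_cons_succ, not_or]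
      tauto
    have hres : (a :: pre).reverse ++ l.set i (l.getD i 0 - m) =
        pre.reverse ++ (a :: l).set (i + 1) ((a :: l).getD (i + 1) 0 - m) := by
      simp [List.reverse_cons]
    by_cases h : i < l.length ∧ m ≤ l.getD i 0 ∧ (l.getD i 0 - m) ∉ a :: pre ∧
        (l.getD i 0 - m) ∉ l.eraseIdx i
    · rw [if_pos h, if_pos (key.1 h), hres]
    · rw [if_neg h, if_neg (fun h' => h (key.2 h'))]

/-- **What `mnSum` computes**: the accumulator plus the sum of `rec` over the surviving branches
at positions `< k`. [folklore] -/
theorem mnSum_eq (rec : List ℕ → ℤ) (α : List ℕ) (m : ℕ) : ∀ (k : ℕ) (acc : ℤ),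
    mnSum rec α m k acc = acc + ∑ i ∈ range k,
      (match stepList α i m [] with
        | none => 0
        | some α' => (-1) ^ invCount α' * callCanon rec (sortDescF α') [])
  | 0, acc => by simp [mnSum]
  | k + 1, acc => by
    rw [Finset.sum_range_succ, ← add_assoc, mnSum]
    cases h : stepList α k m [] with
    | none => simp only [mnSum_eq rec α m k acc, add_zero]
    | some α' => simp only [mnSum_eq rec α m k, add_right_comm]

/-- **`mnCoeff` computes Frobenius's coefficient**: for an exponent list `α` of length `N` with
`∑ α = ∑ ms + f + N(N-1)/2`,
`mnCoeff N f ms α = [x^α] ((∏_{m ∈ ms} p_m) · (a_ρ · p_1^f))`.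
[cite: Macdonald1995, Ch. I §7 Example 5] -/
theorem mnCoeff_eq_coeff : ∀ (ms α : List ℕ), α.length = N → α.sum = ms.sum + f + N * (N - 1) / 2 →
    mnCoeff N f ms α = coeff (fsupp N α) ((ms.map (psum (Fin N) ℤ)).prod *
      (alternant (fun i => (X i : MvPolynomial (Fin N) ℤ)) (rho N) * psum (Fin N) ℤ 1 ^ f))
  | [], α, hN, hsum => by
    rw [mnCoeff, List.map_nil, List.prod_nil, one_mul, coeff_fsupp_tail hN (by simpa using hsum)]
  | m :: ms, α, hN, hsum => by
    rw [mnCoeff, mnSum_eq, zero_add, List.map_cons, List.prod_cons, mul_assoc, psum_fin_eq_sum,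
      coeff_psum_mul, Finset.sum_filter]
    set R := (ms.map (psum (Fin N) ℤ)).prod *
      (alternant (fun i => (X i : MvPolynomial (Fin N) ℤ)) (rho N) * psum (Fin N) ℤ 1 ^ f) with hR
    have hRanti : ∀ g : Equiv.Perm (Fin N),
        rename g R = ((Equiv.Perm.sign g : ℤ) : MvPolynomial (Fin N) ℤ) * R :=
      fun g => rename_prod_psum_mul_alternant_mul_pow ms f g
    -- both sides as sums over `range N`
    have hrhs : (∑ i : Fin N, if m ≤ fsupp N α i then coeff (fsupp N α - Finsupp.single i m) R else 0) =
        ∑ i ∈ range N, (if m ≤ α.getD i 0 then coeff (fsupp N (subAt α i m)) R else 0) := by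
      rw [← Fin.sum_univ_eq_sum_range
        (fun i => if m ≤ α.getD i 0 then coeff (fsupp N (subAt α i m)) R else 0) N]
      refine Finset.sum_congr rfl fun i _ => ?_
      rw [fsupp_apply]
      split_ifs
      · rw [fsupp_sub_single α hN i m]
      · rfl
    rw [hrhs]
    refine Finset.sum_congr rfl fun i hi => ?_
    rw [Finset.mem_range] at hi
    rw [stepList_eq, List.reverse_nil, List.nil_append]
    by_cases hle : m ≤ α.getD i 0
    · rw [if_pos hle]
      by_cases hc : (α.getD i 0 - m) ∈ α.eraseIdx i
      · -- the new entry collides with entry `k ≠ i`: the coefficient vanishes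
        rw [if_neg (by tauto)]
        obtain ⟨k, hk, hki, hkv⟩ := List.mem_eraseIdx_iff_getElem.1 hc
        symm
        refine coeff_eq_zero_of_antisymm_of_apply_eq (i := ⟨i, hi⟩) (j := ⟨k, by omega⟩)
          (fun h => hki (Fin.ext_iff.1 h).symm) (hRanti _) ?_
        rw [fsupp_apply, fsupp_apply, Fin.val_mk, Fin.val_mk, getD_subAt_self α m (by omega),
          getD_subAt_of_ne α m hki, List.getD_eq_getElem _ _ hk, hkv]
      · rw [if_pos ⟨by omega, hle, List.not_mem_nil, hc⟩]
        change (-1) ^ invCount (subAt α i m) * callCanon (mnCoeff N f ms) (sortDescF (subAt α i m)) [] = _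
        have hlen : (subAt α i m).length = N := by rw [length_subAt, hN]
        have hsum' : (subAt α i m).sum = ms.sum + f + N * (N - 1) / 2 := by
          have h := sum_subAt_add α i m (by omega) hle
          simp only [List.sum_cons] at hsum
          omega
        rw [callCanon_eq, List.reverse_nil, List.nil_append, sortDescF_eq, ← sortCount_eq_invCount,
          mnCoeff_eq_coeff ms (sortDesc (subAt α i m)) (by rw [length_sortDesc, hlen])
            (by rw [sum_sortDesc, hsum']),
          ← coeff_fsupp_eq_sortDesc hRanti _ hlen.le]
    · rw [if_neg hle, if_neg (by tauto)]

end Recursion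

/-! ### The character value -/

section Character

/-- The `β`-numbers as an exponent vector are `λ + ρ`. [folklore] -/
theorem fsupp_betaList (L : List ℕ) :
    fsupp L.length (betaList L) =
      Finsupp.equivFunOnFinite.symm ((fun i : Fin L.length => L.getD i 0) + rho L.length) := by
  ext i
  rw [fsupp_apply, Finsupp.coe_equivFunOnFinite_symm, Pi.add_apply, getD_betaList L i.2, rho_apply]
  have := i.2
  omega

/-- **The evaluator computes the characters of the symmetric groups**: for `λ ⊢ n` and
`σ ∈ 𝔖_n`, `χ^λ(σ) = charValue λ.sortedParts n (cycleType σ, sorted decreasingly)` — Frobenius's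
formula, the cycle-type factorization of `F_σ`, and the Murnaghan–Nakayama recursion
`mnCoeff_eq_coeff`. [cite: JamesKerber1981, 2.4.7 with 2.3.15] -/
theorem spechtCharacter_eq_charValue {n : ℕ} (lam : Nat.Partition n) (σ : Equiv.Perm (Fin n)) :
    spechtCharacter ℂ lam σ =
      (charValue lam.sortedParts n (σ.cycleType.sort (· ≥ ·)) : ℂ) := by
  have hN : lam.parts.card ≤ lam.sortedParts.length := by rw [Nat.Partition.length_sortedParts]
  have hms : ((σ.cycleType.sort (· ≥ ·) : List ℕ) : Multiset ℕ) = σ.cycleType := Multiset.sort_eq _ _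
  rw [spechtCharacter_eq_frobeniusChar lam hN σ, frobeniusChar_eq_coeff_prod_cycleType _ σ hms,
    Fintype.card_fin, charValue, ← fsupp_betaList]
  congr 1
  symm
  refine mnCoeff_eq_coeff _ _ (length_betaList _) ?_
  have hle : (σ.cycleType.sort (· ≥ ·)).sum ≤ n := by
    rw [← Multiset.sum_coe, hms, Equiv.Perm.sum_cycleType]
    exact (Finset.card_le_univ _).trans (by rw [Fintype.card_fin])
  have hsumL : lam.sortedParts.sum = n := by
    rw [Nat.Partition.sortedParts, ← Multiset.sum_coe, Multiset.sort_eq, lam.parts_sum]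
  rw [sum_betaList, hsumL]
  omega

end Character

/-! ### Kronecker coefficients: the program -/

section Program

/-- Decreasing lists of naturals in `[2, mx]` with sum `≤ rem` (and length `≤ fuel`).
[folklore] -/
def cycleTypesAux : ℕ → ℕ → ℕ → List (List ℕ)
  | 0, _, _ => [[]]
  | fuel + 1, rem, mx =>
      [] :: (List.range' 2 (min mx rem - 1)).flatMap fun p =>
        (cycleTypesAux fuel (rem - p) p).map fun l => p :: l

/-- **The cycle types of `𝔖_n`** in Mathlib's convention (lengths of the non-trivial cycles): all
decreasing lists of naturals `≥ 2` with sum `≤ n` (`mem_cycleTypes_iff`). [folklore] -/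
def cycleTypes (n : ℕ) : List (List ℕ) := cycleTypesAux n n n

/-- **The number of permutations of `n` letters with non-trivial cycle lengths `l`**:
`n! / ((n - ∑ l)! · ∏ l · ∏_v (#occurrences of v)!)` (Mathlib's `Equiv.Perm.card_of_cycleType`;
Cauchy's `n!/z_ρ`). [cite: JamesKerber1981, 1.2.15] -/
def classSize (n : ℕ) (l : List ℕ) : ℕ :=
  n.factorial / ((n - l.sum).factorial * l.prod * ∏ x ∈ l.toFinset, (l.count x).factorial)

/-- One class's term `#class · χ^μ χ^ν χ^λ`, skipping the class as soon as a factor vanishes.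
[folklore] -/
def kronTerm (n : ℕ) (L M K ms : List ℕ) : ℤ :=
  if charValue M n ms = 0 then 0 else
    if charValue K n ms = 0 then 0 else
      (classSize n ms : ℤ) * (charValue L n ms * charValue M n ms * charValue K n ms)

/-- **The character sum** `∑_ρ #C_ρ χ^λ(ρ) χ^μ(ρ) χ^ν(ρ) = n! g(λ, μ, ν)` from the parts of
`λ, μ, ν ⊢ n` (`factorial_mul_kroneckerCoeff_eq_kronSum`).
[cite: FultonHarrisGTM129, Exercise 4.51] -/
def kronSum (n : ℕ) (L M K : List ℕ) : ℤ := ((cycleTypes n).map (kronTerm n L M K)).sum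

end Program

/-! ### The enumeration of cycle types is sound, complete and repetition-free -/

section CycleTypes

/-- Membership in `[2, k]` as a `List.range'`. [folklore] -/
theorem mem_range'_two_iff {p k : ℕ} : p ∈ List.range' 2 (k - 1) ↔ 2 ≤ p ∧ p ≤ k := by
  rw [List.mem_range'_1]
  omega

/-- Soundness of the enumeration. [folklore] -/
theorem cycleTypesAux_sound : ∀ (fuel rem mx : ℕ) (l : List ℕ), l ∈ cycleTypesAux fuel rem mx →
    l.Pairwise (· ≥ ·) ∧ (∀ a ∈ l, 2 ≤ a ∧ a ≤ mx) ∧ l.sum ≤ rem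
  | 0, rem, mx, l, h => by
    simp only [cycleTypesAux, List.mem_singleton] at h
    subst h
    simp
  | fuel + 1, rem, mx, l, h => by
    simp only [cycleTypesAux, List.mem_cons, List.mem_flatMap, List.mem_map] at h
    rcases h with rfl | ⟨p, hp, t, ht, rfl⟩
    · simp
    · rw [mem_range'_two_iff] at hp
      obtain ⟨hsorted, hmem, hsum⟩ := cycleTypesAux_sound fuel (rem - p) p t ht
      refine ⟨List.pairwise_cons.2 ⟨fun a ha => (hmem a ha).2, hsorted⟩, fun a ha => ?_, ?_⟩
      · rcases List.mem_cons.1 ha with rfl | ha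
        · exact ⟨hp.1, (le_min_iff.1 hp.2).1⟩
        · exact ⟨(hmem a ha).1, (hmem a ha).2.trans (le_min_iff.1 hp.2).1⟩
      · rw [List.sum_cons]
        have := (le_min_iff.1 hp.2).2
        omega

/-- Completeness of the enumeration. [folklore] -/
theorem cycleTypesAux_complete : ∀ (fuel rem mx : ℕ) (l : List ℕ), l.Pairwise (· ≥ ·) →
    (∀ a ∈ l, 2 ≤ a ∧ a ≤ mx) → l.sum ≤ rem → l.length ≤ fuel → l ∈ cycleTypesAux fuel rem mx
  | 0, rem, mx, l, _, _, _, hlen => by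
    rw [Nat.le_zero, List.length_eq_zero_iff] at hlen
    subst hlen
    simp [cycleTypesAux]
  | fuel + 1, rem, mx, [], _, _, _, _ => by simp [cycleTypesAux]
  | fuel + 1, rem, mx, p :: t, hs, hmem, hsum, hlen => by
    rw [List.pairwise_cons] at hs
    rw [List.sum_cons] at hsum
    simp only [cycleTypesAux, List.mem_cons, List.mem_flatMap, List.mem_map]
    refine Or.inr ⟨p, ?_, t, ?_, rfl⟩
    · rw [mem_range'_two_iff]
      exact ⟨(hmem p (by simp)).1, le_min (hmem p (by simp)).2 (by omega)⟩
    · refine cycleTypesAux_complete fuel (rem - p) p t hs.2 (fun a ha => ⟨(hmem a (by simp [ha])).1,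
        hs.1 a ha⟩) (by omega) (by simpa using hlen)

/-- No repetitions in the enumeration. [folklore] -/
theorem nodup_cycleTypesAux : ∀ (fuel rem mx : ℕ), (cycleTypesAux fuel rem mx).Nodup
  | 0, rem, mx => by simp [cycleTypesAux]
  | fuel + 1, rem, mx => by
    rw [cycleTypesAux, List.nodup_cons]
    constructor
    · simp [List.mem_flatMap]
    · rw [List.nodup_flatMap]
      constructor
      · intro p _
        exact (nodup_cycleTypesAux fuel (rem - p) p).map fun _ _ h => List.cons_injective h
      · have hr : (List.range' 2 (min mx rem - 1)).Nodup := List.nodup_range' 1 Nat.one_pos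
        refine hr.imp fun {a b} hab => ?_
        simp only [Function.onFun]
        rw [List.disjoint_left]
        intro x hx hx'
        obtain ⟨t, -, rfl⟩ := List.mem_map.1 hx
        obtain ⟨t', -, h⟩ := List.mem_map.1 hx'
        exact hab (List.cons_eq_cons.1 h).1.symm

/-- A decreasing list of naturals `≥ 2` is at most half as long as its sum. [folklore] -/
theorem two_mul_length_le_sum {l : List ℕ} (h : ∀ a ∈ l, 2 ≤ a) : 2 * l.length ≤ l.sum := by
  induction l with
  | nil => simp
  | cons a l ih =>
    rw [List.length_cons, List.sum_cons]
    have := h a (by simp)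
    have := ih fun b hb => h b (by simp [hb])
    omega

/-- **The enumeration is exactly the set of cycle types**: a list is in `cycleTypes n` iff it is
decreasing with all entries `≥ 2` and sum `≤ n`. [folklore] -/
theorem mem_cycleTypes_iff {n : ℕ} {l : List ℕ} :
    l ∈ cycleTypes n ↔ l.Pairwise (· ≥ ·) ∧ (∀ a ∈ l, 2 ≤ a) ∧ l.sum ≤ n := by
  constructor
  · intro h
    obtain ⟨hs, hmem, hsum⟩ := cycleTypesAux_sound n n n l h
    exact ⟨hs, fun a ha => (hmem a ha).1, hsum⟩
  · rintro ⟨hs, hmem, hsum⟩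
    refine cycleTypesAux_complete n n n l hs (fun a ha => ⟨hmem a ha, ?_⟩) hsum ?_
    · exact (List.le_sum_of_mem ha).trans hsum
    · have := two_mul_length_le_sum hmem
      omega

/-- **The enumeration has no repetitions.** [folklore] -/
theorem nodup_cycleTypes (n : ℕ) : (cycleTypes n).Nodup := nodup_cycleTypesAux n n n

/-- The decreasing sort of a cycle type is in the enumeration. [folklore] -/
theorem sort_cycleType_mem_cycleTypes {n : ℕ} (σ : Equiv.Perm (Fin n)) :
    σ.cycleType.sort (· ≥ ·) ∈ cycleTypes n := by
  refine mem_cycleTypes_iff.2 ⟨Multiset.pairwise_sort _ _, fun a ha => ?_, ?_⟩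
  · exact Equiv.Perm.two_le_of_mem_cycleType ((Multiset.mem_sort _).1 ha)
  · rw [← Multiset.sum_coe, Multiset.sort_eq, Equiv.Perm.sum_cycleType]
    exact (Finset.card_le_univ _).trans (by rw [Fintype.card_fin])

/-- A decreasing list is the decreasing sort of its multiset. [folklore] -/
theorem sort_coe_eq_of_pairwise {l : List ℕ} (hl : l.Pairwise (· ≥ ·)) :
    (l : Multiset ℕ).sort (· ≥ ·) = l := by
  rw [Multiset.coe_sort]
  exact List.mergeSort_eq_self (r := (· ≥ ·)) hl

/-- **`classSize` is the number of permutations with the given cycle type.**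
[cite: JamesKerber1981, 1.2.15] -/
theorem card_filter_cycleType_eq_classSize {n : ℕ} {l : List ℕ} (hl : l ∈ cycleTypes n) :
    ((univ : Finset (Equiv.Perm (Fin n))).filter fun σ => σ.cycleType = (l : Multiset ℕ)).card =
      classSize n l := by
  classical
  obtain ⟨-, hmem, hsum⟩ := mem_cycleTypes_iff.1 hl
  have h := Equiv.Perm.card_of_cycleType (α := Fin n) (l : Multiset ℕ)
  rw [Fintype.card_fin, if_pos ⟨by rwa [Multiset.sum_coe], fun a ha => hmem a ha⟩] at h
  rw [h, classSize]
  simp only [Multiset.sum_coe, Multiset.prod_coe, List.toFinset_coe, Multiset.coe_count]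

end CycleTypes

/-! ### The character sum -/

section KroneckerSum

variable {n : ℕ}

/-- The class term without the shortcut. [folklore] -/
theorem kronTerm_eq (L M K ms : List ℕ) :
    kronTerm n L M K ms =
      (classSize n ms : ℤ) * (charValue L n ms * charValue M n ms * charValue K n ms) := by
  rw [kronTerm]
  split_ifs with h1 h2
  · rw [h1]; ring
  · rw [h2]; ring
  · rfl

/-- **The class equation for the character sum**:
`∑_{σ ∈ 𝔖_n} χ^λ(σ) χ^μ(σ) χ^ν(σ) = kronSum n λ μ ν` (as complex numbers).
[cite: FultonHarrisGTM129, Exercise 4.51] -/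
theorem sum_spechtCharacter_mul_mul_eq_kronSum (lam mu nu : Nat.Partition n) :
    ∑ σ : Equiv.Perm (Fin n), spechtCharacter ℂ lam σ * spechtCharacter ℂ mu σ * spechtCharacter ℂ nu σ =
      (kronSum n lam.sortedParts mu.sortedParts nu.sortedParts : ℂ) := by
  classical
  set L := lam.sortedParts
  set M := mu.sortedParts
  set K := nu.sortedParts
  -- the summand as a function of the cycle type
  set Φ : Multiset ℕ → ℤ := fun m =>
    charValue L n (m.sort (· ≥ ·)) * charValue M n (m.sort (· ≥ ·)) * charValue K n (m.sort (· ≥ ·))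
    with hΦ
  have hterm : ∀ σ : Equiv.Perm (Fin n),
      spechtCharacter ℂ lam σ * spechtCharacter ℂ mu σ * spechtCharacter ℂ nu σ =
        ((Φ σ.cycleType : ℤ) : ℂ) := by
    intro σ
    rw [spechtCharacter_eq_charValue lam σ, spechtCharacter_eq_charValue mu σ,
      spechtCharacter_eq_charValue nu σ, hΦ]
    push_cast
    rfl
  simp_rw [hterm]
  -- regroup by cycle type
  rw [Finset.sum_comp (fun m : Multiset ℕ => ((Φ m : ℤ) : ℂ)) (fun σ : Equiv.Perm (Fin n) => σ.cycleType)]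
  -- enlarge the index set to the enumeration
  set S : Finset (Multiset ℕ) := (cycleTypes n).toFinset.image (fun l : List ℕ => (l : Multiset ℕ))
    with hS
  have hsub : (univ : Finset (Equiv.Perm (Fin n))).image (fun σ => σ.cycleType) ⊆ S := by
    intro m hm
    obtain ⟨σ, -, rfl⟩ := Finset.mem_image.1 hm
    exact Finset.mem_image.2 ⟨_, List.mem_toFinset.2 (sort_cycleType_mem_cycleTypes σ),
      Multiset.sort_eq _ _⟩
  rw [Finset.sum_subset hsub (fun m _ hm => by
    have h0 : ((univ : Finset (Equiv.Perm (Fin n))).filter fun σ => σ.cycleType = m).card = 0 := by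
      rw [Finset.card_eq_zero, Finset.filter_eq_empty_iff]
      intro σ _ hσ
      exact hm (Finset.mem_image.2 ⟨σ, Finset.mem_univ _, hσ⟩)
    rw [h0, zero_smul])]
  -- the sum over the enumeration, as a list sum
  have hinj : Set.InjOn (fun l : List ℕ => (l : Multiset ℕ)) ↑(cycleTypes n).toFinset := by
    intro l₁ h₁ l₂ h₂ h
    rw [Finset.mem_coe, List.mem_toFinset] at h₁ h₂
    have e₁ := sort_coe_eq_of_pairwise (mem_cycleTypes_iff.1 h₁).1
    have e₂ := sort_coe_eq_of_pairwise (mem_cycleTypes_iff.1 h₂).1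
    rw [← e₁, ← e₂]
    exact congrArg _ h
  rw [hS, Finset.sum_image hinj, List.sum_toFinset _ (nodup_cycleTypes n), kronSum, Int.cast_list_sum,
    List.map_map]
  congr 1
  refine List.map_congr_left fun l hl => ?_
  rw [Function.comp_apply, kronTerm_eq, card_filter_cycleType_eq_classSize hl, hΦ]
  simp only [sort_coe_eq_of_pairwise (mem_cycleTypes_iff.1 hl).1, nsmul_eq_mul]
  push_cast
  ring

/-- **The evaluator computes Kronecker coefficients**:
`n! · g(λ, μ, ν) = kronSum n λ.sortedParts μ.sortedParts ν.sortedParts`.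
[cite: FultonHarrisGTM129, Exercise 4.51] -/
theorem factorial_mul_kroneckerCoeff_eq_kronSum (lam mu nu : Nat.Partition n) :
    ((n.factorial * kroneckerCoeff ℂ lam mu nu : ℕ) : ℤ) =
      kronSum n lam.sortedParts mu.sortedParts nu.sortedParts := by
  have h := kroneckerCoeff_eq_sum_spechtCharacter_holds ℂ lam mu nu
  rw [sum_spechtCharacter_mul_mul_eq_kronSum] at h
  exact_mod_cast h

/-- **Positivity test**: `g(λ, μ, ν) > 0 ↔ kronSum n λ μ ν > 0` (decidable by `decide` on closed
instances). [cite: FultonHarrisGTM129, Exercise 4.51] -/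
theorem kroneckerCoeff_pos_iff_kronSum_pos (lam mu nu : Nat.Partition n) :
    0 < kroneckerCoeff ℂ lam mu nu ↔ 0 < kronSum n lam.sortedParts mu.sortedParts nu.sortedParts := by
  rw [← factorial_mul_kroneckerCoeff_eq_kronSum, Int.natCast_pos, Nat.mul_pos_iff_of_pos_left
    (Nat.factorial_pos n)]

/-- **The value**: `g(λ, μ, ν) = kronSum n λ μ ν / n!` (exact division in `ℤ`).
[cite: FultonHarrisGTM129, Exercise 4.51] -/
theorem kroneckerCoeff_eq_kronSum_div (lam mu nu : Nat.Partition n) :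
    (kroneckerCoeff ℂ lam mu nu : ℤ) =
      kronSum n lam.sortedParts mu.sortedParts nu.sortedParts / n.factorial := by
  rw [← factorial_mul_kroneckerCoeff_eq_kronSum, Nat.cast_mul,
    Int.mul_ediv_cancel_left _ (by exact_mod_cast (Nat.factorial_ne_zero n))]

end KroneckerSum

end MNEval

end Literature.RepresentationTheory.FiniteGroups
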